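/-
Copyright (c) 2026 the pub-hodgecm-mathlib formalisation cell (harness21).  Prover seat hodgecm-mathlib-K2Liu-p01 (g8), Track B «K2-LIT»,
#184♮ = hLiu418 = `stmt-HodgeConjecture-24832`; #42S organ S1 ROAD W, witness TOP FILE part (W1-c) (RECIPE-F7-InertWitnessTopFile 80571dd96a2cf31d §C): the two box facts
on the hyperbolic Gram `A σ(B)ᵀ + B σ(A)ᵀ + d·C σ(C)ᵀ` consumed by ★ (W1-b) `halfForm_mem_primePowBall_of_boxes` through ★ κ-comp (K2): it is HERMITIAN, and INTEGRAL on the `S₁²`-box.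
-/
import Summits.HodgeConjecture.HodgeConjecture.Theorems.K2LiuLocalRingValuationBalls   -- ★ E-det balls `ball_add`, `ball_mul`, `ball_conjLocal`, `ball_antitone`
import HarnessLib

/-!
# Crux `HLiu418`, #42S-S1 ROAD W, (W1-c): THE HYPERBOLIC GRAM IS HERMITIAN AND INTEGRAL ON THE WITNESS BOX

Cell `hodgecm-mathlib`, crux item hLiu418 = `stmt-HodgeConjecture-24832` (helper lane `--supports … --as helper`, count-neutral).  THEOREMS ONLY (no `def`, no instance,
no notation, no named-fact hypothesis, no `sorry`).  §1 GENERIC (comm ring `R`, involution `σ`); §2 the E-det ball currency on `E ⊗ F_v` (★ `K2LiuLocalRingValuationBalls`).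

WHY.  ★ κ-comp p860223 (K2) identifies ★ (T3a)'s frame Gram `G̃(x)` with the hyperbolic Gram `H(A,B,C) := vecMulVec A (σ∘B) + vecMulVec B (σ∘A) + d • vecMulVec C (σ∘C)` of
`(A,B,C) = κ x`; ★ (W1-b) `K2LiuWitnessPhaseOnBox.halfForm_mem_primePowBall_of_boxes` wants `G̃(x)` HERMITIAN and in `ball_b`.  On the witness box `S₁² = {A, B ∈ ball_0, C ∈ ball_k}`
(`k ≥ 0`, `d` integral and `σ`-fixed) both hold with `b = 0`:
* §1 **`herm_hypGram`** — `(H.map σ)ᵀ = H` (any comm ring, `σ` involutive, `σ d = d`);  `hypGram_apply`.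
* §2 **`hypGram_mem_ball_zero`** — `A, B ∈ ball_0`, `C ∈ ball_k` (`0 ≤ k`), `d ∈ ball_0` ⇒ `H ∈ ball_0` entrywise (★ `ball_mul`∕`ball_add`∕`ball_conjLocal`∕`ball_antitone`).
[Shimura1997, §13.2] [Jacobowitz1962, §4] [CasselsFrohlichANT1967, Ch. II §10].
HONEST LABEL.  Count-neutral helper; `HC_CM` is proved only modulo the 7 printed citations (2 remaining named inputs: hLiu418 = `stmt-HodgeConjecture-24832`,
h413 = `stmt-HodgeConjecture-24833`) until rung 0 closes.

## References
* [Shimura1997] G. Shimura, CBMS 93 (1997), §13.2.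
* [Jacobowitz1962] R. Jacobowitz, Amer. J. Math. 84 (1962), §4.
* [CasselsFrohlichANT1967] J. W. S. Cassels, A. Fröhlich (eds.), *Algebraic Number Theory* (1967), Ch. II §10.
-/

set_option autoImplicit false
set_option linter.dupNamespace false -- the mandated namespace repeats `HodgeConjecture.HodgeConjecture`

noncomputable section

open NumberField IsDedekindDomain Matrix
open Literature.NumberTheory.Automorphic Literature.NumberTheory.Automorphic.UnitaryGroup

namespace Summit.HodgeConjecture.HodgeConjecture.Cruxes.HLiu418.K2LiuHyperbolicGramBox


/-! ## §1 The hyperbolic Gram is hermitian -/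

section Algebra

variable {R : Type*} [CommRing R] (σ : R →+* R) {m : Type*}

/-- entries of the hyperbolic Gram. [folklore] -/
theorem hypGram_apply (d : R) (A B C : m → R) (j i : m) :
    (vecMulVec A (σ ∘ B) + vecMulVec B (σ ∘ A) + d • vecMulVec C (σ ∘ C)) j i = A j * σ (B i) + B j * σ (A i) + d * (C j * σ (C i)) := by
  simp only [Matrix.add_apply, Matrix.smul_apply, vecMulVec_apply, Function.comp_apply, smul_eq_mul]

/-- **THE HYPERBOLIC GRAM IS HERMITIAN** (`σ` involutive, `σ d = d`). [cite: Shimura1997, §13.2] [cite: Jacobowitz1962, §4] -/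
theorem herm_hypGram (hσ : ∀ x, σ (σ x) = x) {d : R} (hd : σ d = d) (A B C : m → R) :
    ((vecMulVec A (σ ∘ B) + vecMulVec B (σ ∘ A) + d • vecMulVec C (σ ∘ C)).map σ)ᵀ = vecMulVec A (σ ∘ B) + vecMulVec B (σ ∘ A) + d • vecMulVec C (σ ∘ C) := by
  ext j i
  rw [transpose_apply, map_apply, hypGram_apply, hypGram_apply, map_add, map_add, map_mul, map_mul, map_mul, map_mul, hσ, hσ, hσ, hd]
  ring

end Algebra

/-! ## §2 The hyperbolic Gram is integral on the witness box -/

section Balls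

variable (F : Type) [Field F] [NumberField F] (E : Type) [Field E] [NumberField E] [Algebra F E] (c : E ≃ₐ[F] E)
  (v : HeightOneSpectrum (𝓞 F)) {π : v.adicCompletion F} (hπ : Valued.v π = WithZero.exp (-1 : ℤ)) {m : Type*}

include hπ in
/-- **THE HYPERBOLIC GRAM IS INTEGRAL ON THE BOX `S₁² = {A, B ∈ ball_0, C ∈ ball_k}`** (`0 ≤ k`, `d ∈ ball_0`): every entry of
`A σ(B)ᵀ + B σ(A)ᵀ + d·C σ(C)ᵀ` lies in `ball_0`. [cite: CasselsFrohlichANT1967, Ch. II §10] [cite: Shimura1997, §13.2] -/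
theorem hypGram_mem_ball_zero {d : LocalRing E v} (hd : ∀ w : PlacesOver E v, Valued.v (d w) ≤ Valued.v (toPlace v w π) ^ (0 : ℤ))
    {k : ℤ} (hk : 0 ≤ k) {A B C : m → LocalRing E v}
    (hA : ∀ j (w : PlacesOver E v), Valued.v (A j w) ≤ Valued.v (toPlace v w π) ^ (0 : ℤ))
    (hB : ∀ j (w : PlacesOver E v), Valued.v (B j w) ≤ Valued.v (toPlace v w π) ^ (0 : ℤ))
    (hC : ∀ j (w : PlacesOver E v), Valued.v (C j w) ≤ Valued.v (toPlace v w π) ^ k) (j i : m) :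
    ∀ w : PlacesOver E v, Valued.v ((vecMulVec A (conjLocal E c v ∘ B) + vecMulVec B (conjLocal E c v ∘ A) + d • vecMulVec C (conjLocal E c v ∘ C)) j i w) ≤
      Valued.v (toPlace v w π) ^ (0 : ℤ) := by
  intro w
  rw [hypGram_apply]
  have h1 : ∀ w : PlacesOver E v, Valued.v ((A j * conjLocal E c v (B i)) w) ≤ Valued.v (toPlace v w π) ^ ((0 : ℤ) + 0) :=
    K2LiuLocalRingValuationBalls.ball_mul F E v hπ (hA j) (K2LiuLocalRingValuationBalls.ball_conjLocal F E c v (hB i))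
  have h2 : ∀ w : PlacesOver E v, Valued.v ((B j * conjLocal E c v (A i)) w) ≤ Valued.v (toPlace v w π) ^ ((0 : ℤ) + 0) :=
    K2LiuLocalRingValuationBalls.ball_mul F E v hπ (hB j) (K2LiuLocalRingValuationBalls.ball_conjLocal F E c v (hA i))
  have h3 : ∀ w : PlacesOver E v, Valued.v ((d * (C j * conjLocal E c v (C i))) w) ≤ Valued.v (toPlace v w π) ^ ((0 : ℤ) + (k + k)) :=
    K2LiuLocalRingValuationBalls.ball_mul F E v hπ hd (K2LiuLocalRingValuationBalls.ball_mul F E v hπ (hC j) (K2LiuLocalRingValuationBalls.ball_conjLocal F E c v (hC i)))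
  have h3' : ∀ w : PlacesOver E v, Valued.v ((d * (C j * conjLocal E c v (C i))) w) ≤ Valued.v (toPlace v w π) ^ (0 : ℤ) :=
    K2LiuLocalRingValuationBalls.ball_antitone F E v hπ (by linarith) h3
  rw [add_zero] at h1 h2
  exact K2LiuLocalRingValuationBalls.ball_add F E v (K2LiuLocalRingValuationBalls.ball_add F E v h1 h2) h3' w

end Balls

end Summit.HodgeConjecture.HodgeConjecture.Cruxes.HLiu418.K2LiuHyperbolicGramBox

end
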